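import Mathlib
import HarnessLib
import Summits.Ventures.LatticeQCDFlow.Exactness.FlowSamplerExact
import Summits.Ventures.LatticeQCDFlow.Exactness.NCMCGeneralSpacePathIMH
import Summits.Ventures.LatticeQCDFlow.Exactness.NCMCGeneralSpaceMarkovErgodicCriteria

/-!
# Independence Metropolis is ergodic for every positive weight: the exact flow sampler and the path-IMH lane are consistent with no bound on the importance weights

HONEST FRAMING: exact (Metropolis-corrected) sampling algorithms for lattice gauge theory;
figures of merit are autocorrelation/cost numbers at stated couplings and volumes; no
continuum-physics claim.

Venture `LatticeQCDFlow` (cell pub-lqcd), topic `Exactness`; FANOUT row 13 (`eng-snf`, GEN-17).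
NEW WORK of the cell, not a published result; no definition is introduced; nothing is cited as a
fact (Birkhoff's theorem enters as the tree-PROVED
`Literature.Dynamics.Ergodic.birkhoff_ergodic_theorem_of_ergodic_holds`).  Named only:
Mengersen–Tweedie 1996 (the independence sampler is UNIFORMLY ergodic iff the weight is essentially
bounded); Tierney 1994 §3 (irreducibility of the independence sampler when `π ≪ q`).

WHY.  Every ergodicity statement for row 30's general flow-MCMC kernel `indepMH q w`
(`Exactness/IMHKernel.lean`) in the tree is UNIFORM ergodicity from a BOUNDED weight
(`indepMH_apply_ge`, `Phi4FlowSamplerErgodic.flowMCMC_uniformly_ergodic`, row 8's Doeblin files):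
a rate, at the price of `sup w < ∞`.  For the qualitative statement the engines actually rely on —
time averages converge to target expectations — NO bound is needed: a pointwise positive weight
makes every almost-invariant set trivial, so the chain started in its invariant law is ergodic
(GEN-16's criterion `GeneralNCMC.ergodic_shift_chain`), and Birkhoff gives the strong law for every
integrable observable.  This covers flows with unbounded importance weights (φ⁴ models whose flow
has lighter tails than the target) and the path-IMH lane of `latflow-snf` for every Crooks pair
with no work floor.

## Content

* §1 `imhAcceptE_pos`, `setLIntegral_imhAcceptE_le_indepMH`, `measure_eq_zero_of_indepMH_eq_zero`
  (`K(x, B) = 0`, `x ∉ B` or not, forces `q(B ∖ {x}) …` — precisely: `∫_B a(x, y) q(dy) = 0 ⇒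
  q(B) = 0`); **`indepMH_ae_invariant_trivial`** — for `w > 0` measurable and ANY probability law
  `μ`: a measurable set almost invariant for `indepMH q w` under `μ` is `μ`-trivial;
  **`ergodic_indepMH`** — the chain started in any invariant probability law is shift-ergodic;
  `tendsto_sum_div_ae_indepMH` — time averages of integrable observables converge a.s.
* §2 **`ergodic_flowMCMC`**, **`tendsto_sum_div_ae_flowMCMC`** — THE EXACT FLOW SAMPLER
  (`FlowSamplerExact.lean`: reference volume `vol`, positive measurable densities `p` (target) and
  `q̃` (model) with `p · vol`, `q̃ · vol` probability laws, kernel `indepMH (q̃ · vol) (p/q̃)`): started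
  in the target it is ergodic and `(1/n) Σ_{i<n} φ(x_i) → ∫ φ p dvol` a.s. for every
  `φ ∈ L¹(p · vol)` — for EVERY flow with positive density, bounded weights or not.
* §3 **`CrooksPair.invariant_pathIMH_fwdPathLaw`**, **`CrooksPair.ergodic_pathIMH`**,
  **`CrooksPair.tendsto_endpointMean_ae_pathIMH`** — THE PATH-IMH LANE: for every Crooks pair
  between finite non-zero weights, the independence-Metropolis chain on records with proposal `P_F`
  and weight `e^{−W}` leaves `P_R = fwdPathLaw ν₁ κR` invariant, is ergodic from `P_R`, and the
  readings of a measurable `g ∈ L¹(ν₁)` at the END POINTS of the current records average to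
  `Z₁⁻¹ ∫ g dν₁` almost surely — no work floor, no bound on `e^{−W}`.

NOT CLAIMED: rates (those need the weight bound — Mengersen–Tweedie's converse says uniform
ergodicity FAILS for unbounded weights); statements from a fixed initial point (the results are
along the chain started in the invariant law, i.e. for almost every start); error bars.
-/

namespace Summit.Ventures.LatticeQCDFlow.Exactness

open MeasureTheory ProbabilityTheory Set Filter Finset
open scoped ENNReal Topology

variable {Ω : Type*} [MeasurableSpace Ω]

/-! ## §1 Independence Metropolis with a positive weight has no non-trivial almost-invariant set -/

section IMH

variable {q : Measure Ω} [IsProbabilityMeasure q] {w : Ω → ℝ}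

omit [MeasurableSpace Ω] [IsProbabilityMeasure q] in
/-- The acceptance density is pointwise positive for a positive weight. -/
theorem imhAcceptE_pos (hw0 : ∀ x, 0 < w x) (x y : Ω) : 0 < imhAcceptE w x y :=
  ENNReal.ofReal_pos.2 (lt_min one_pos (div_pos (hw0 y) (hw0 x)))

/-- The accepted-proposal part bounds the kernel from below: `∫_B a(x, y) q(dy) ≤ K(x, B)`. -/
theorem setLIntegral_imhAcceptE_le_indepMH (hw : Measurable w) (x : Ω) {B : Set Ω}
    (hB : MeasurableSet B) : ∫⁻ y in B, imhAcceptE w x y ∂q ≤ indepMH q w x B := by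
  rw [indepMH_apply hw x hB]
  exact le_self_add

/-- **A set the chain cannot enter from some state is model-null**: `K(x, B) = 0 ⇒ q(B) = 0`
(positive weight: every proposal is accepted with positive probability). -/
theorem measure_eq_zero_of_indepMH_eq_zero (hw : Measurable w) (hw0 : ∀ x, 0 < w x) (x : Ω)
    {B : Set Ω} (hB : MeasurableSet B) (h0 : indepMH q w x B = 0) : q B = 0 := by
  have h1 : ∫⁻ y in B, imhAcceptE w x y ∂q = 0 :=
    le_antisymm ((setLIntegral_imhAcceptE_le_indepMH hw x hB).trans h0.le) bot_le
  rw [lintegral_eq_zero_iff (measurable_imhAcceptE hw).of_uncurry_left] at h1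
  have hfalse : ∀ᵐ y ∂(q.restrict B), False :=
    h1.mono fun y hy => (imhAcceptE_pos hw0 x y).ne' hy
  rw [eventually_false_iff_eq_bot, ae_eq_bot, Measure.restrict_eq_zero] at hfalse
  exact hfalse

/-- **No non-trivial almost-invariant set.**  For a positive measurable weight and ANY probability
law `μ` carrying the almost-invariance: a measurable `B` with `K(x, Bᶜ) = 0` for `μ`-a.e. `x ∈ B`
and `K(x, B) = 0` for `μ`-a.e. `x ∉ B` is `μ`-trivial (else both `B` and `Bᶜ` would be `q`-null). -/
theorem indepMH_ae_invariant_trivial (hw : Measurable w) (hw0 : ∀ x, 0 < w x) (μ : Measure Ω)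
    [IsProbabilityMeasure μ] (B : Set Ω) (hB : MeasurableSet B)
    (hout : ∀ᵐ x ∂μ, x ∈ B → indepMH q w x Bᶜ = 0) (hin : ∀ᵐ x ∂μ, x ∉ B → indepMH q w x B = 0) :
    μ B = 0 ∨ μ B = 1 := by
  by_cases hB0 : μ B = 0
  · exact Or.inl hB0
  by_cases hBc : μ Bᶜ = 0
  · exact Or.inr ((prob_compl_eq_zero_iff hB).1 hBc)
  exfalso
  obtain ⟨x, -, hx⟩ := GeneralNCMC.exists_of_ae_imp hout hB0
  obtain ⟨y, -, hy⟩ := GeneralNCMC.exists_of_ae_imp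
    (hin.mono fun z hz hzB => hz hzB : ∀ᵐ z ∂μ, z ∈ Bᶜ → indepMH q w z B = 0) hBc
  have h1 : q Bᶜ = 0 := measure_eq_zero_of_indepMH_eq_zero hw hw0 x hB.compl hx
  have h2 : q B = 0 := measure_eq_zero_of_indepMH_eq_zero hw hw0 y hB hy
  have : q univ = 0 := by
    rw [← Set.union_compl_self B, measure_union disjoint_compl_right hB.compl, h1, h2, add_zero]
  exact (IsProbabilityMeasure.ne_zero q) (Measure.measure_univ_eq_zero.1 this)

/-- **INDEPENDENCE METROPOLIS WITH A POSITIVE WEIGHT IS ERGODIC** from every invariant probability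
law (in particular from its target `w · q`, normalised): no bound on the weight is needed. -/
theorem ergodic_indepMH (hw : Measurable w) (hw0 : ∀ x, 0 < w x) {π : Measure Ω}
    [IsProbabilityMeasure π] (hπ : Kernel.Invariant (indepMH q w) π) :
    haveI : Fact (Measurable w) := ⟨hw⟩
    Ergodic (fun (x : ℕ → Ω) (k : ℕ) => x (k + 1))
      (Kernel.trajMeasure (X := fun _ : ℕ => Ω) π
        (fun n : ℕ => (indepMH q w).comap (fun h : (j : ↥(Finset.Iic n)) → Ω =>
          h ⟨n, Finset.mem_Iic.2 le_rfl⟩) (measurable_pi_apply _))) := by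
  haveI : Fact (Measurable w) := ⟨hw⟩
  exact GeneralNCMC.ergodic_shift_chain _ hπ fun B hB hout hin =>
    indepMH_ae_invariant_trivial hw hw0 π B hB hout hin

/-- Hence the strong law: along the chain started in an invariant probability law `π`, the time
average of every `π`-integrable observable converges to its `π`-mean almost surely. -/
theorem tendsto_sum_div_ae_indepMH (hw : Measurable w) (hw0 : ∀ x, 0 < w x) {π : Measure Ω}
    [IsProbabilityMeasure π] (hπ : Kernel.Invariant (indepMH q w) π) {φ : Ω → ℝ}
    (hφ : Integrable φ π) :
    haveI : Fact (Measurable w) := ⟨hw⟩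
    ∀ᵐ x ∂(Kernel.trajMeasure (X := fun _ : ℕ => Ω) π
        (fun n : ℕ => (indepMH q w).comap (fun h : (j : ↥(Finset.Iic n)) → Ω =>
          h ⟨n, Finset.mem_Iic.2 le_rfl⟩) (measurable_pi_apply _))),
      Tendsto (fun n : ℕ => (∑ i ∈ range n, φ (x i)) / n) atTop (𝓝 (∫ a, φ a ∂π)) := by
  haveI : Fact (Measurable w) := ⟨hw⟩
  exact GeneralNCMC.tendsto_sum_div_ae_chain _ (ergodic_indepMH hw hw0 hπ) hπ hφ

end IMH

/-! ## §2 The exact flow sampler is consistent for every flow with positive density -/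

section Flow

variable {vol : Measure Ω} {p q : Ω → ℝ}

/-- **THE EXACT FLOW SAMPLER IS ERGODIC FOR EVERY FLOW.**  Reference volume `vol`, target density
`p > 0`, model density `q̃ > 0` (both measurable, `p · vol` and `q̃ · vol` probability laws): the
flow-MCMC chain `indepMH (q̃ · vol) (p/q̃)` started in the target is ergodic — whatever the flow,
with no bound on the importance weight `p/q̃`. -/
theorem ergodic_flowMCMC (hp : Measurable p) (hq : Measurable q) (hp0 : ∀ x, 0 < p x)
    (hq0 : ∀ x, 0 < q x) [IsProbabilityMeasure (vol.withDensity fun x => ENNReal.ofReal (q x))]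
    [IsProbabilityMeasure (vol.withDensity fun x => ENNReal.ofReal (p x))] :
    haveI : Fact (Measurable fun x => p x / q x) := ⟨hp.div hq⟩
    Ergodic (fun (x : ℕ → Ω) (k : ℕ) => x (k + 1))
      (Kernel.trajMeasure (X := fun _ : ℕ => Ω) (vol.withDensity fun x => ENNReal.ofReal (p x))
        (fun n : ℕ => (indepMH (vol.withDensity fun x => ENNReal.ofReal (q x))
          (fun x => p x / q x)).comap (fun h : (j : ↥(Finset.Iic n)) → Ω =>
            h ⟨n, Finset.mem_Iic.2 le_rfl⟩) (measurable_pi_apply _))) :=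
  ergodic_indepMH (hp.div hq) (fun x => div_pos (hp0 x) (hq0 x)) (flowMCMC_invariant hp hq hp0 hq0)

/-- **THE EXACT FLOW SAMPLER IS CONSISTENT FOR EVERY FLOW**: along the chain started in the
target, `(1/n) Σ_{i<n} φ(x_i) → ∫ φ d(p · vol)` almost surely for every `φ ∈ L¹(p · vol)`. -/
theorem tendsto_sum_div_ae_flowMCMC (hp : Measurable p) (hq : Measurable q) (hp0 : ∀ x, 0 < p x)
    (hq0 : ∀ x, 0 < q x) [IsProbabilityMeasure (vol.withDensity fun x => ENNReal.ofReal (q x))]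
    [IsProbabilityMeasure (vol.withDensity fun x => ENNReal.ofReal (p x))] {φ : Ω → ℝ}
    (hφ : Integrable φ (vol.withDensity fun x => ENNReal.ofReal (p x))) :
    haveI : Fact (Measurable fun x => p x / q x) := ⟨hp.div hq⟩
    ∀ᵐ x ∂(Kernel.trajMeasure (X := fun _ : ℕ => Ω) (vol.withDensity fun x => ENNReal.ofReal (p x))
        (fun n : ℕ => (indepMH (vol.withDensity fun x => ENNReal.ofReal (q x))
          (fun x => p x / q x)).comap (fun h : (j : ↥(Finset.Iic n)) → Ω =>
            h ⟨n, Finset.mem_Iic.2 le_rfl⟩) (measurable_pi_apply _))),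
      Tendsto (fun n : ℕ => (∑ i ∈ range n, φ (x i)) / n) atTop
        (𝓝 (∫ a, φ a ∂(vol.withDensity fun x => ENNReal.ofReal (p x)))) :=
  tendsto_sum_div_ae_indepMH (hp.div hq) (fun x => div_pos (hp0 x) (hq0 x))
    (flowMCMC_invariant hp hq hp0 hq0) hφ

end Flow

/-! ## §3 The path-IMH lane: ergodic for every Crooks pair, end-point readings consistent -/

namespace GeneralNCMC.CrooksPair

variable {E : Type*} [MeasurableSpace E]
variable {ν₀ ν₁ : Measure Ω} [IsFiniteMeasure ν₀] [IsFiniteMeasure ν₁] {κF κR : Kernel Ω E}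
  [IsMarkovKernel κF] [IsMarkovKernel κR] {s e : E → Ω} {W : E → ℝ}

omit [IsFiniteMeasure ν₁] [IsMarkovKernel κR] in
/-- **`P_R` is invariant for the path-IMH kernel** (proposal `P_F`, weight `e^{−W}`): the
probability-normalised form of `pathIMH_invariant`. -/
theorem invariant_pathIMH_fwdPathLaw (h0 : ν₀ univ ≠ 0) (h : CrooksPair ν₀ ν₁ κF κR s e W) :
    haveI := isProbabilityMeasure_fwdPathLaw ν₀ h0 κF
    Kernel.Invariant (indepMH (fwdPathLaw ν₀ κF) fun ε => Real.exp (-W ε)) (fwdPathLaw ν₁ κR) := by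
  haveI := isProbabilityMeasure_fwdPathLaw ν₀ h0 κF
  have key := invariant_smul (indepMH (fwdPathLaw ν₀ κF) fun ε => Real.exp (-W ε))
    (h.pathIMH_invariant h0) (ν₀ univ * (ν₁ univ)⁻¹)
  have hs : (ν₀ univ * (ν₁ univ)⁻¹) • ((ν₀ univ)⁻¹ • ν₁.bind κR) = fwdPathLaw ν₁ κR := by
    rw [fwdPathLaw, smul_smul, mul_comm (ν₀ univ), mul_assoc,
      ENNReal.mul_inv_cancel h0 (measure_ne_top ν₀ univ), mul_one]
  rw [hs] at key
  exact key

/-- **THE PATH-IMH LANE IS ERGODIC FOR EVERY CROOKS PAIR.**  Between finite non-zero level weights,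
the independence-Metropolis chain on records with proposal `P_F` and weight `e^{−W}`, started in its
invariant law `P_R`, is shift-ergodic — no work floor, no bound on `e^{−W}`. -/
theorem ergodic_pathIMH (h0 : ν₀ univ ≠ 0) (h1 : ν₁ univ ≠ 0) (h : CrooksPair ν₀ ν₁ κF κR s e W) :
    haveI := isProbabilityMeasure_fwdPathLaw ν₀ h0 κF
    haveI := isProbabilityMeasure_fwdPathLaw ν₁ h1 κR
    haveI : Fact (Measurable fun ε => Real.exp (-W ε)) :=
      ⟨Real.measurable_exp.comp h.measurable_W.neg⟩
    Ergodic (fun (x : ℕ → E) (k : ℕ) => x (k + 1))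
      (Kernel.trajMeasure (X := fun _ : ℕ => E) (fwdPathLaw ν₁ κR)
        (fun n : ℕ => (indepMH (fwdPathLaw ν₀ κF) fun ε => Real.exp (-W ε)).comap
          (fun hh : (j : ↥(Finset.Iic n)) → E => hh ⟨n, Finset.mem_Iic.2 le_rfl⟩)
          (measurable_pi_apply _))) := by
  haveI := isProbabilityMeasure_fwdPathLaw ν₀ h0 κF
  haveI := isProbabilityMeasure_fwdPathLaw ν₁ h1 κR
  exact ergodic_indepMH (Real.measurable_exp.comp h.measurable_W.neg) (fun ε => Real.exp_pos _)
    (h.invariant_pathIMH_fwdPathLaw h0)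

omit [IsFiniteMeasure ν₀] [IsFiniteMeasure ν₁] [IsMarkovKernel κF] in
/-- The end-point law of `P_R` is the normalised target: `P_R ∘ e⁻¹ = Z₁⁻¹ • ν₁`. -/
theorem map_end_fwdPathLaw_rev (h : CrooksPair ν₀ ν₁ κF κR s e W) :
    (fwdPathLaw ν₁ κR).map e = (ν₁ univ)⁻¹ • ν₁ := by
  rw [fwdPathLaw, Measure.map_smul, h.map_end_bind_rev]

/-- **END-POINT READINGS OF THE PATH-IMH CHAIN ARE CONSISTENT.**  For every Crooks pair between
finite non-zero level weights and every measurable `g ∈ L¹(ν₁)`: along the path-IMH chain started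
in `P_R`, `(1/n) Σ_{i<n} g(e(ω_i)) → Z₁⁻¹ ∫ g dν₁` almost surely — the lane estimates normalised
target expectations with no work floor. -/
theorem tendsto_endpointMean_ae_pathIMH (h0 : ν₀ univ ≠ 0) (h1 : ν₁ univ ≠ 0)
    (h : CrooksPair ν₀ ν₁ κF κR s e W) {g : Ω → ℝ} (hgm : Measurable g) (hg : Integrable g ν₁) :
    haveI := isProbabilityMeasure_fwdPathLaw ν₀ h0 κF
    haveI := isProbabilityMeasure_fwdPathLaw ν₁ h1 κR
    haveI : Fact (Measurable fun ε => Real.exp (-W ε)) :=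
      ⟨Real.measurable_exp.comp h.measurable_W.neg⟩
    ∀ᵐ x ∂(Kernel.trajMeasure (X := fun _ : ℕ => E) (fwdPathLaw ν₁ κR)
        (fun n : ℕ => (indepMH (fwdPathLaw ν₀ κF) fun ε => Real.exp (-W ε)).comap
          (fun hh : (j : ↥(Finset.Iic n)) → E => hh ⟨n, Finset.mem_Iic.2 le_rfl⟩)
          (measurable_pi_apply _))),
      Tendsto (fun n : ℕ => (∑ i ∈ range n, g (e (x i))) / n) atTop
        (𝓝 (((ν₁ univ).toReal)⁻¹ * ∫ y, g y ∂ν₁)) := by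
  haveI := isProbabilityMeasure_fwdPathLaw ν₀ h0 κF
  haveI := isProbabilityMeasure_fwdPathLaw ν₁ h1 κR
  -- `g ∘ e` is `P_R`-integrable with mean `Z₁⁻¹ ∫ g dν₁`
  have hmap := h.map_end_fwdPathLaw_rev
  have hge : Integrable g ((fwdPathLaw ν₁ κR).map e) := by
    rw [hmap]
    exact hg.smul_measure (ENNReal.inv_ne_top.2 h1)
  have hint : Integrable (fun ε => g (e ε)) (fwdPathLaw ν₁ κR) := hge.comp_measurable h.measurable_e
  have hval : ∫ ε, g (e ε) ∂(fwdPathLaw ν₁ κR) = ((ν₁ univ).toReal)⁻¹ * ∫ y, g y ∂ν₁ := by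
    rw [← integral_map h.measurable_e.aemeasurable hgm.aestronglyMeasurable, hmap,
      integral_smul_measure, ENNReal.toReal_inv, smul_eq_mul]
  have key := tendsto_sum_div_ae_indepMH (Real.measurable_exp.comp h.measurable_W.neg)
    (fun ε => Real.exp_pos _) (h.invariant_pathIMH_fwdPathLaw h0) hint
  rw [hval] at key
  exact key

end GeneralNCMC.CrooksPair

end Summit.Ventures.LatticeQCDFlow.Exactness
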